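import Summits.QuantumFields.QCD.Theorems.SmallFieldUltracontractivity.Negative.Tightness

/-!
# Disproof of `SmallFieldUltracontractivity` (crux stmt-QuantumFields-8871) — standing adversary file

Crux (route `HeatSlicedQuarks`, rank 2): `∃ ε > 0, K, C` such that for every torus side `L`, SU(3)
field `U`, mass `m ∈ [-1/2, 1]`, site `x`, scale `1 ≤ r ≤ L`: if every plaquette based within
`torusDist ≤ K·r` of `x` has deficit `3 - Re tr U_p ≤ (ε/r²)²`, then for `1 ≤ t ≤ r²` every
colour–spin entry of `exp(-t·D_Wᴴ D_W)` at `(x,x)` is `≤ C/t²` (`D_W = wilsonDirac ρ₃ U m 1`).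

## Findings (cycle 1, refuter-cdisprove-stmt-QuantumFields-8871-0, 2026-08-16)

**Verdict so far: NO KILL.  The statement resists every attack below; the reason it resists is a
one-line *sup principle* (§C) which also tells the provers what the real content is.**

* LANDED THROUGH THE GATE (sorry-free, standard axioms), namespace
  `Summit.QuantumFields.QCD.Theorems.SmallFieldUltracontractivity.Negative`:
  - p73477 `Theorems/SmallFieldUltracontractivity/Negative/LoadBearing.lean` (commit 5e9cea9d13f9) = §0/§A;
  - p74675 `Theorems/SmallFieldUltracontractivity/Negative/Tightness.lean` (commit dd1ae6f72b89) = §T.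
  This work file IMPORTS them (re-exported below, so every name is also available as
  `Summit.QuantumFields.QCD.Cruxes.SmallFieldUltracontractivity.Disproof.<name>`) and keeps only the
  documented near-miss §B and the (empty) targets section §E locally.
* §A LOAD-BEARING ANALYSIS (Lean, sorry-free): the three order hypotheses on `t` and `r` are each
  load-bearing *as typed*, by the degenerate one-site torus `L = 1`, `U ≡ 1`, `m = 0`, where the
  tree's `wilsonDirac` is *literally the zero matrix* (`wilsonDirac_freeCfg_one`: at `L = 1` both
  hopping branches fire and cancel the `m + 4r` diagonal), so the heat kernel is `1` for all `t`:
  - `smallFieldUltracontractivity_false_without_t_le_rsq` : drop `t ≤ r²` ⇒ false (`t → ∞`);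
  - `smallFieldUltracontractivity_false_without_r_le_L`  : drop `r ≤ L` ⇒ false (`r → ∞`, `t = r²`);
  - `smallFieldUltracontractivity_false_without_one_le_t` : drop `1 ≤ t` ⇒ false, but ONLY through
    `t ≤ 0` (at `t = 0` the bound reads `1 ≤ C/0 = 0`); for `0 < t < 1` the bound is automatic once
    `C ≥ 1` because every entry of `exp(-tH)`, `H = DᴴD ≥ 0`, has modulus `≤ 1` — PROVED here for
    every complex square matrix (`norm_exp_neg_smul_conjTranspose_mul_self_apply_le_one`, spectral
    theorem + AM–GM on the unitary rows; sorry-free).  Corollaries, also proved: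
    `kernelEntry_le_one`; `body_holds_at_fixed_volume` (for each FIXED `L` the inner statement
    holds with `C = L⁴`, so only `L → ∞` families can refute and no finite counterexample search is
    meaningful); `posT_of_smallFieldUltracontractivity` (the crux implies its own `0 < t` version
    with `C ↦ max C 1`, i.e. `1 ≤ t` carries no content beyond `0 < t`).
* §T TIGHTNESS (Lean, sorry-free; landed as `Negative/Tightness.lean`, p74675): T*T identity
  `e^{-tH}(i,i) = Σ_j |e^{-(t/2)H}(i,j)|²` (diagonal bound ⇔ `ℓ²→ℓ^∞` bound of the half-time kernel —
  the form the sup principle §C and the ideator's `InteriorSupBound` use), all entries dominated by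
  the diagonal (Cauchy–Schwarz), zero modes fixed by the semigroup, the constant spinors are exact
  zero modes of the tree's free massless `wilsonDirac` on every torus, hence the floor
  `Re e^{-tH}(x,x)_{aα,aα} ≥ 1/L⁴` for `U ≡ 1`, `m = 0`, ALL `t`, `L`; consequently
  `not_smallFieldUltracontractivityExp`: the strengthening `C/t^{2+δ}` is FALSE for every `δ > 0`
  (free field, `r = L`, `t = L²`, `L → ∞`) — the planner's exponent `2` is the right one, and any
  admissible `C` is `≥ 1`.  (This also re-proves `t ≤ r²` load-bearing junk-free at every `L`.)
* §B NATURAL STRENGTHENINGS THAT ARE FALSE (physics certain, not formalisable here — recorded as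
  `def`s with a documented `sorry`, evidence = kit job in the docstring once it returns):
  - `AdmissibleOnlyUltracontractivity` (replace `(ε/r²)²` by `ε²`, i.e. plain admissibility):
    false by Landau levels — constant abelian flux `B` (deficit `≈ B²/… ≤ ε²`) has a lowest Landau
    level of density `≍ B²/4π²` per site whose real `D_W`-eigenvalue `≈ m + B` is cancelled by an
    allowed `m ∈ [-1/2, 0)`, so `e^{-tH}(x,x) ≳ B²` for all `t ≤ L²`, `≫ C/t²`.  This is exactly the
    planner's own recalibration argument (route text "Landau saturation"); it shows the SCALE
    COVARIANCE `ε/r²` is load-bearing.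
  - dropping the smallness hypothesis altogether: false a fortiori (Banks–Casher rate `t^{-1/2}`,
    item `UniformLocalSpectralBound` is the matching upper bound).
* §C WHY IT RESISTS — the sup principle (prose, this docblock; the provers' real target).
  For `H = DᴴD ≥ 0` on the finite torus let `P_E` be the spectral projector on `[0, E]` and
  `μ_x` the spectral measure of `δ_{x,a,α}`.  Then
  `e^{-tH}((x,a,α),(x,a,α)) = ∫ e^{-tE} dμ_x(E) ≤ Σ_{k≥0} e^{-k} μ_x([0,(k+1)/t])` and
  `μ_x([0,E]) = ‖P_E δ‖² = sup { |ψ(x,a,α)|² : ψ ∈ Ran P_E, ‖ψ‖ = 1 }`.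
  So the crux is EQUIVALENT (up to constants) to a *local sup bound for energy-band-limited
  vectors*: `M_x(E) := sup{|ψ(x)|² : ψ ∈ Ran P_E, ‖ψ‖=1} ≤ C·max(E, r⁻²)²` whenever `U` is
  `(ε/r²)`-flat on `B(x, Kr)`.  For `ψ ∈ Ran P_E` one has `‖Hʲψ‖ ≤ Eʲ` for all `j`, and inside the
  ball `H` acts as the (gauge-fixed, near-free) local operator, so `M_x(E) ≤ C E²` for
  `E ≥ r⁻²` is Gårding's crude spectral-function estimate `e(x,x,λ) ≤ C λ^{n/m}` (here `n = 4`,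
  order `m = 2`) proved by rescaling `B(x, E^{-1/2})` to unit size + interior elliptic `L² → L^∞`
  estimates for the constant-coefficient lattice symbol `h(p) = (m + W(p))² + Σ sin² p_μ`
  (uniformly elliptic at low frequency for `m ≥ -1/2`: `h(p) - m² ≥ (1+m)·Σ 2(1 - cos p_μ)`), with
  the gauge field entering only as an `εK`-small first-order perturbation after a ball gauge
  `|A| ≲ εK/r` — NO derivative of `A` is needed at this level because the perturbation is treated in
  the rescaled Sobolev scale, not by a Duhamel series in `t` (this answers the planner's
  "(εr)ⁿ divergence" worry the same way the ideator's `InteriorSupBound` T*T card does).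
  CONSEQUENCE FOR ATTACKS: every EXTERIOR mechanism is dead on arrival — whatever sits outside
  `B(x,Kr)` (Haar sea, Aoki-phase reservoir, constant-flux annulus with its huge LLL, a dense shell
  of instantons tuned to their common crossing mass), an in-window normalised `ψ` is near-free in the
  ball and cannot beat the mean-value bound at `x`.  I checked the two most dangerous ones by hand:
  (i) flux annulus / Aharonov–Casher: the exterior LLL modes continue into the flat ball as
  `z₁^a z₂^b`-type harmonics, exponentially small at depth `≫` spacing — only `O(1)` of them are
  visible at the centre, each `≍ R⁻⁴`; (ii) shell of `N ≍ (D/ρ)³` instantons of size `ρ ≍ √D` at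
  distance `D ≍ Kr` (each has an in-window real mode `λ ≈ c₁/ρ² ≤ 1/r` with a massless
  `ρ²/d⁶` tail reaching `x`): the NAIVE incoherent sum `N ρ²/D⁶ ≍ D^{-7/2} ≫ D⁻⁴` is wrong — the
  tails are mutually coherent (Gram matrix `G = 1 + O((ρ/d_ij)²)` has eigenvalue `≍ Nρ²/D²` exactly
  on the `ℓ = 1` shell harmonic that the centre tail vector `T_i(x) ∝ (x - y_i)̸` lives in), and
  `LDOS(x) = T† G⁻¹ T ≍ (Nρ²/D⁶)/(Nρ²/D²) = D⁻⁴`: power counting is restored on the nose; random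
  colour orientations only change this by the internal dimension (push-through identity
  `X(1 + mX†X)⁻¹X† → 1/m`).  Single objects (instanton at crossing mass, dislocation, toron, flux
  quantum) all land at `≍ const·r⁻⁴` by dimensional analysis (rattack's log, re-derived).
* §D HYPOTHESES PROBABLY NOT LOAD-BEARING (information, not theorems): by §C the window `t ≤ r²`
  could be `t ≤ c(Kr)²`; `K = 1` should already work (flatness on `B(x, √t)` plus a collar);
  the mass window is used only through low-frequency ellipticity `1 + m > 0` and the doubler gap —
  for `m ∉ [-1/2,1]` away from `{0,-2,-4,-6,-8}` the free `H` is gapped (`h ≥ min(m², (m+2)²,…)`)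
  and the bound is trivial in flat balls, near the doubler points it is free power counting with
  more species; so `m ∈ [-1/2,1]` is a convenience (it is where `WilsonLichnerowicz` holds), not
  a necessity for THIS item.
* §E Targets: none yet (`stuck_stubs = []`).

House rules of this file: prose only in docstrings; `sorry` only on documented near-misses (§B).
-/

namespace Summit.QuantumFields.QCD.Cruxes.SmallFieldUltracontractivity.Disproof

open Literature.MathematicalPhysics.QuantumLattice Literature.MathematicalPhysics.QuantumFieldTheory
open Literature.Probability.LatticeModels (TorusSite)
open Summit.QuantumFields.QCD.Theorems.SmallFieldUltracontractivity.Negative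
open scoped Matrix

noncomputable section

/-! ## §0/§A/§T — landed: `Theorems/SmallFieldUltracontractivity/Negative/{LoadBearing,Tightness}.lean`

Re-exported names: -/

export Summit.QuantumFields.QCD.Theorems.SmallFieldUltracontractivity.Negative (SU3 freeCfg kernelEntry
  plaquetteHolonomy_freeCfg deficit_freeCfg smallness_freeCfg linkHop_freeCfg_one wilsonHop_freeCfg_one
  wilsonDirac_freeCfg_one wilsonDirac_freeCfg_one_zero kernelEntry_freeCfg_one_zero unitary_row_norm_sq
  norm_exp_neg_smul_conjTranspose_mul_self_apply_le_one kernelEntry_le_one body_holds_at_fixed_volume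
  SmallFieldUltracontractivityPosT posT_of_smallFieldUltracontractivity
  SmallFieldUltracontractivityWithout_t_le_rsq smallFieldUltracontractivity_false_without_t_le_rsq
  SmallFieldUltracontractivityWithout_r_le_L smallFieldUltracontractivity_false_without_r_le_L
  SmallFieldUltracontractivityWithout_one_le_t smallFieldUltracontractivity_false_without_one_le_t
  isHermitian_neg_smul_conjTranspose_mul_self isHermitian_exp_neg_smul
  exp_neg_smul_apply_self_eq_sum_norm_sq norm_sq_exp_neg_smul_apply_le mulVecCLM mulVecCLM_apply
  exp_smul_mulVec_eq_self_of_mulVec_eq_zero exp_neg_smul_mulVec_eq_self_of_mulVec_eq_zero constSpinor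
  wilsonDirac_freeCfg_apply_const wilsonDirac_freeCfg_mulVec_constSpinor sum_norm_sq_constSpinor
  norm_sq_le_re_exp_apply_self_of_mulVec_eq_zero re_exp_freeCfg_apply_self_ge
  SmallFieldUltracontractivityExp not_smallFieldUltracontractivityExp)

/-- Sanity: the landed load-bearing and tightness theorems are available here. -/
example : ¬ SmallFieldUltracontractivityWithout_t_le_rsq ∧ ¬ SmallFieldUltracontractivityWithout_r_le_L ∧
    ¬ SmallFieldUltracontractivityWithout_one_le_t ∧ ∀ δ : ℝ, 0 < δ → ¬ SmallFieldUltracontractivityExp δ :=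
  ⟨smallFieldUltracontractivity_false_without_t_le_rsq, smallFieldUltracontractivity_false_without_r_le_L,
    smallFieldUltracontractivity_false_without_one_le_t, fun _ hδ => not_smallFieldUltracontractivityExp hδ⟩

/-! ## §B Natural strengthenings that are false (documented near-misses) -/

/-- STRENGTHENING 1 — admissibility only (the scale covariance `ε/r²` replaced by a flat `ε`):
plaquette deficits `≤ ε²` on the `K·r`-ball should NOT give free power counting up to `t = r²`. -/
def AdmissibleOnlyUltracontractivity : Prop :=
  ∃ ε : ℝ, 0 < ε ∧ ∃ K : ℕ, ∃ C : ℝ, ∀ (L : ℕ) [NeZero L] (U : GaugeConfig 4 L SU3) (m : ℝ),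
    m ∈ Set.Icc (-(1 / 2 : ℝ)) 1 → ∀ (x : TorusSite 4 L) (r : ℕ), 1 ≤ r → r ≤ L →
    (∀ y : TorusSite 4 L, torusDist x y ≤ K * r → ∀ μ ν : Fin 4,
      3 - ((fundamentalRep (Fin 3)) (plaquetteHolonomy U y μ ν)).trace.re ≤ ε ^ 2) →
    ∀ (t : ℝ), 1 ≤ t → t ≤ (r : ℝ) ^ 2 → ∀ (a b : Fin 3) (α β : Fin 4),
      kernelEntry U m t x a b α β ≤ C / t ^ 2

/-- NEAR-MISS (physics certain, no Lean proof attempted): `¬ AdmissibleOnlyUltracontractivity`.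
Two independent witness families, both needing a NEGATIVE mass (for `m ∈ [0,1]` accretivity
`Re D_W = m + ½K_U` pins every would-be low mode at `|D_W| ≳` its kinetic energy, and the
admissible-only statement restricted to `m ≥ 0` is plausibly TRUE with `C ≍ ε⁻²` — planners note):
(1) SINGLE INSTANTON (works for every `ε`): a lattice instanton of size `ρ ≍ ε^{-1/2}` (deficit
`≍ ρ⁻⁴ ≤ ε²` everywhere) in flat surroundings has a real `D_W(0)`-eigenvalue `λ₀ ≈ c₁/ρ² ∈ (0, 1/2]`;
at `m := -λ₀ ∈ [-1/2, 0)` the operator `D_W(m) = D_W(0) + m` has an EXACT zero mode localised at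
scale `ρ`, weight `|ψ(x)|² ≍ ρ⁻⁴ ≍ ε²` at the core, uniformly in `L ≥ L₀`; by
`norm_sq_le_re_exp_apply_self_of_mulVec_eq_zero` the kernel entry at the core is `≥ c(ε) > 0` for ALL
`t`, contradicting `C/t²` at `r = L`, `t = L²`, `L → ∞` (violation `≍ ε² L⁴`).
(2) LANDAU LEVELS (extensive version, the planner's own recalibration argument): constant abelian
flux `B = 2πn/L²` in the `01` and `23` planes embedded as `diag(e^{iθ}, e^{-iθ}, 1) ∈ SU(3)`
(deficit `2(1 - cos B) ≈ B² ≤ ε²`), `m := -λ₀` on the lowest Landau level (`λ₀ ≈ B`): `≍ 2n²`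
near-zero modes spread uniformly, `e^{-tH}(x,x) ≳ B²/(4π²)` for all `t ≤ L²` (violation `≍ B²L⁴`).
OBSTRUCTION to a Lean proof: both need infinite-volume spectral input (existence and localisation of
the crossing mode, resp. the Hofstadter–Wilson LLL bandwidth `≪ 1/L`); compactly supported exact
eigenvectors of `D_W` do not exist for ANY `U` (a corner site of the support would need
`ψ(x) ∈ ker(1-γ_μ) ∩ ker(1+γ_ν)`, `μ ≠ ν`, which is `{0}` for anticommuting involutions), so no
finite witness is available.  NUMERICAL EVIDENCE (kit job j013853, evidence `compute-j013853.json`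
on the crux item; matrix-free Chebyshev heat kernel of the tree's `wilsonDirac`, validated at `L = 4`
against dense `expm` to `2·10⁻¹⁶`, `Re D_W ≥ m` exact, `‖D_W(0)‖ = 8.000`): writing
`κ(t) := t²·(1/12)Σ_{aα} K_t(x aα, x aα)` and `κ_max(t) := t²·max_{aα,bβ}|K_t|`,
(F) free `U ≡ 1`, `m = 0`: `κ(1) = 0.00507`, `κ(L²) = 1.0000` exactly for `L = 8, 12` (the zero-mode
floor of `re_exp_freeCfg_apply_self_ge` is attained); (S) ONE flux quantum per plane, `B = 2π/L²`,
deficit `= (2π/L²)²·(1 + O(B²))`, i.e. the crux's hypothesis at `r = L` with `ε = 2π`: `max_m κ(L²) =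
0.717 (L = 8), 0.734 (L = 12)`, `max_m κ_max(L²) = 3.00, 2.88`, maximiser `m ≈ -B` — BOUNDED, as the
crux predicts (`C ≈ 3`); (A) admissible-only, `B = π/8` fixed (`n = L²/16` quanta, deficit
`0.152 = ε²`): `max_m κ(L²) = 2.85 (L = 8) → 13.51 (L = 12)` at `m = -0.375`, `κ_max(L²) = 17.1 → 81.0`,
ratio `4.7 ≈ (12/8)⁴ = 5.1`, and the raw trace `Σ_{aα}K_{L²} = 7.82·10⁻³` at `L = 12` equals the
Landau-level prediction `2B²/(4π²) = 7.81·10⁻³` to three figures — so `K_t(x,x) → B²/(2π²)`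
independently of `t ≤ L²` and `κ ≍ t²`: the strengthening is false; at `m = 0` instead `κ(L²) = 0.333`
for both `L` (only the neutral colour's free zero mode), consistent with admissible-only ∧ `m ≥ 0`
being true.  (L = 16 run: job j013858, auto-attached.) -/
theorem not_admissibleOnlyUltracontractivity : ¬ AdmissibleOnlyUltracontractivity := by
  sorry

/-! ## §E Targets (lead's stuck stubs) — none filed yet -/

end

end Summit.QuantumFields.QCD.Cruxes.SmallFieldUltracontractivity.Disproof
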